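import Mathlib
import HarnessLib
import Literature.Analysis.FluidPDE.TypeIAncientMildRescale
import Summits.NavierStokesRegularity.NavierStokesRegularity.Theorems.PoloidalWindowDoorPoloidalWindowRigidityTimeHeightShearWeight
import Summits.NavierStokesRegularity.NavierStokesRegularity.Theorems.PoloidalWindowDoorPoloidalWindowRigidityConstantShearSlice
import Summits.NavierStokesRegularity.NavierStokesRegularity.Theorems.PoloidalWindowDoorPoloidalWindowRigidityMaterialLeibniz
import Summits.NavierStokesRegularity.NavierStokesRegularity.Theorems.PoloidalWindowDoorPoloidalWindowRigiditySlopeFunctionPressure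
import Summits.NavierStokesRegularity.NavierStokesRegularity.Theorems.PoloidalWindowDoorPoloidalWindowRigidityVelocityGradientLaw
import Summits.NavierStokesRegularity.NavierStokesRegularity.Theorems.PoloidalWindowDoorLrcModEntireSheetFlattenTools

/-!
# Route `PoloidalWindowDoor`, item `LrcModEntire` (stmt-NavierStokesRegularity-20428), cell (Q4-sonic, straight branch), case I, PERIODIC branch —
# THE WEIGHT SOURCE IS INVARIANT UNDER HORIZONTAL TRANSLATIONS (input of the difference row (E3_D), T2B-g17 v8 §8(8b))

Cell ns-regularity-ideate, LEAD-lineage seat ns-poloidal-K2-p3 g17 (`--supports stmt-NavierStokesRegularity-20428`).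

ns-poloidal-K2-p2 g4's `…TimeHeightShearWeight.horizFDeriv_weightSource_eq_zero`: on the stratum (TH) the doubled weight source
`2𝒜 := 2(1−μ)f₂ − 2(μ_t − μ_zz)v₂ − μ_z v₂² + 4μ_z∂₂v₂` (`f` the intrinsic residual) has zero HORIZONTAL gradient at every point near which the
slab law `∂₂v_b = μ(t,x₂)∂_bv₂` holds.  Here: the source is differentiable everywhere (class regularity), hence — integrating along a horizontal
segment, which never leaves the slab — **`2𝒜(t, x + e) = 2𝒜(t, x)` for every horizontal `e` and every `x` of the slab**
(`weightSource_translate_eq`; the source is written out in full, exactly as in `horizFDeriv_weightSource_eq_zero` — no new definition).  Plus the GLUE the periodic branch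
needs about the translate `v(·, · + a)`: it is a class profile (`class_translate`, binder form of Literature `IsTypeIAncientMild.comp_add_right`), poloidal
(`poloidal_translate`), with the same slab law for horizontal `a` (`slabLaw_translate`).  Consequence used by the periodic branch of the case-I kill (memo §8(8b)): the (TH) vertical equations of `v` and of
its horizontal translate `v(·, · + L e)` have the SAME source, so their difference (E3_D) is a linear equation in the differences with no source term.

WHAT THIS IS NOT: not a claim about Navier–Stokes regularity and not a stub of the registry; class-level bookkeeping for the residual research cell
`stub_Q4sonicLineNeg` of `Cruxes/LrcModEntire/Lines/twist_split.lean` v13 (bears_on LADDER-NS N0 via item 20428).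
-/

noncomputable section

set_option linter.dupNamespace false

namespace Summit.NavierStokesRegularity.NavierStokesRegularity.Theorems.PoloidalWindowDoorLrcModEntireWeightSourceTranslate

open Set Function Filter Topology Metric InnerProductSpace
open scoped RealInnerProductSpace InnerProductSpace Laplacian ContDiff
open Literature.Analysis Literature.Analysis.FluidPDE
open Summit.NavierStokesRegularity.NavierStokesRegularity.Theorems.LocalSineTubeDoorProfileAlignedWindowRigidityAncient
open Summit.NavierStokesRegularity.NavierStokesRegularity.Theorems.PoloidalWindowDoorPoloidalWindowRigidityWindow
open Summit.NavierStokesRegularity.NavierStokesRegularity.Theorems.PoloidalWindowDoorPoloidalWindowRigidityVelocityGradientLaw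
open Summit.NavierStokesRegularity.NavierStokesRegularity.Theorems.PoloidalWindowDoorPoloidalWindowRigidityMaterialLeibniz
open Summit.NavierStokesRegularity.NavierStokesRegularity.Theorems.PoloidalWindowDoorPoloidalWindowRigidityConstantShearSlice
open Summit.NavierStokesRegularity.NavierStokesRegularity.Theorems.PoloidalWindowDoorPoloidalWindowRigiditySlopeFunctionPressure
open Summit.NavierStokesRegularity.NavierStokesRegularity.Theorems.PoloidalWindowDoorPoloidalWindowRigidityTimeHeightShearPressure
open Summit.NavierStokesRegularity.NavierStokesRegularity.Theorems.PoloidalWindowDoorPoloidalWindowRigidityTimeHeightShearWeight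
open Summit.NavierStokesRegularity.NavierStokesRegularity.Theorems.PoloidalWindowDoorLrcModEntireSheetFlattenTools

variable {C : ℝ} {v : ℝ → EuclideanSpace ℝ (Fin 3) → EuclideanSpace ℝ (Fin 3)}

section Class

variable (hrate : HasTypeITimeDecay C v) (hcont : ContinuousOn (uncurry v) (Iio (0 : ℝ) ×ˢ univ))
  (hmild : ∀ s t : ℝ, s < t → t < 0 → ∀ x,
    v t x = UnboundedOperators.heatExtension (v s) (t - s) x - oseenDuhamel 1 s v v t x)
  (hdiv : ∀ t < 0, VectorCalculus.IsDivFree (v t))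
include hrate hcont hmild hdiv

/-- **The weight source is differentiable everywhere** (class regularity: `∂ₜv(t,·)`, `(v·∇)v`, `Δv`, `∂₂v₂`, `v₂` are `C^∞`; `μ ∈ C³`). -/
theorem differentiable_weightSource {μ : ℝ → ℝ → ℝ} (hμ : ContDiff ℝ 3 (uncurry μ)) {t : ℝ} (ht : t < 0) :
    Differentiable ℝ (fun y : EuclideanSpace ℝ (Fin 3) =>
      2 * (1 - μ t (y 2)) * (timeDerivWithin (Iio 0) v t y + convect (v t) (v t) y - Δ (v t) y) 2
      - 2 * (deriv (fun s => μ s (y 2)) t - deriv (deriv (μ t)) (y 2)) * v t y 2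
      - deriv (μ t) (y 2) * v t y 2 ^ 2
      + 4 * deriv (μ t) (y 2) * fderiv ℝ (v t) y (EuclideanSpace.single 2 1) 2) := by
  have hA : IsTypeIAncientMild C v := isTypeIAncientMild_of_class hrate hcont hmild hdiv
  have hs : ContDiff ℝ ∞ (v t) := hA.contDiff_slice ht
  have hμ2 : ContDiff ℝ 2 (uncurry μ) := hμ.of_le (by norm_cast)
  have hμt3 : ContDiff ℝ 3 (μ t) := hμ.comp (contDiff_const.prodMk contDiff_id)
  have hμ'2 : ContDiff ℝ 2 (deriv (μ t)) :=
    (contDiff_succ_iff_deriv.1 (hμt3 : ContDiff ℝ ((2 : ℕ∞) + 1 : ℕ∞) (μ t))).2.2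
  have hμ''1 : ContDiff ℝ 1 (deriv (deriv (μ t))) :=
    (contDiff_succ_iff_deriv.1 (hμ'2 : ContDiff ℝ ((1 : ℕ∞) + 1 : ℕ∞) (deriv (μ t)))).2.2
  have hMt_eq : (fun z => deriv (fun s => μ s z) t) = fun z => fderiv ℝ (uncurry μ) (t, z) (1, 0) := funext fun z =>
    (hasDerivAt_timeSlice_of_uncurry ((hμ2.differentiable (by norm_num)) (t, z))).deriv
  have hMt2 : ContDiff ℝ 2 (fun z => deriv (fun s => μ s z) t) := by
    rw [hMt_eq]
    exact ((hμ.fderiv_right (m := 2) (by norm_cast)).clm_apply contDiff_const).comp (contDiff_const.prodMk contDiff_id)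
  have hR : Differentiable ℝ (fun y => timeDerivWithin (Iio 0) v t y + convect (v t) (v t) y - Δ (v t) y) := by
    have h1 : ContDiff ℝ ∞ (timeDerivWithin (Iio 0) v t) := by
      rw [timeDerivWithin_Iio_eq_deriv ht]; exact contDiff_timeDeriv_slice hrate hcont hmild hdiv ht
    have h2 : ContDiff ℝ ∞ (fun y => convect (v t) (v t) y) := (hs.fderiv_right (m := ∞) (by norm_cast)).clm_apply hs
    have h3 : ContDiff ℝ 1 (Δ (v t)) := contDiff_laplacian (n := 1) (hs.of_le (by norm_cast))
    exact ((h1.differentiable (by simp)).add (h2.differentiable (by simp))).sub (h3.differentiable (by simp))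
  have hR2 : Differentiable ℝ (fun y => (timeDerivWithin (Iio 0) v t y + convect (v t) (v t) y - Δ (v t) y) 2) :=
    (EuclideanSpace.proj (𝕜 := ℝ) (2 : Fin 3) : EuclideanSpace ℝ (Fin 3) →L[ℝ] ℝ).differentiable.comp hR
  have hE : Differentiable ℝ (fun y => fderiv ℝ (v t) y (EuclideanSpace.single 2 1) 2) :=
    (contDiff_fderiv_coord hrate hcont hmild hdiv ht (EuclideanSpace.single 2 1) 2).differentiable (by simp)
  have hθ : Differentiable ℝ (fun y => v t y 2) := (contDiff_vert_slice hrate hcont hmild hdiv ht).differentiable (by simp)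
  have hw1 : Differentiable ℝ (fun y : EuclideanSpace ℝ (Fin 3) => μ t (y 2)) :=
    (contDiff_comp_height (hμt3.of_le (by norm_cast))).differentiable (by norm_num)
  have hw2 : Differentiable ℝ (fun y : EuclideanSpace ℝ (Fin 3) => deriv (fun s => μ s (y 2)) t) :=
    (contDiff_comp_height hMt2).differentiable (by norm_num)
  have hw3 : Differentiable ℝ (fun y : EuclideanSpace ℝ (Fin 3) => deriv (deriv (μ t)) (y 2)) :=
    (contDiff_comp_height hμ''1).differentiable (by norm_num)
  have hw4 : Differentiable ℝ (fun y : EuclideanSpace ℝ (Fin 3) => deriv (μ t) (y 2)) :=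
    (contDiff_comp_height hμ'2).differentiable (by norm_num)
  exact (((((hw1.const_sub 1).const_mul 2).mul hR2).sub (((hw2.sub hw3).const_mul 2).mul hθ)).sub
    (hw4.mul (hθ.pow 2))).add ((hw4.const_mul 4).mul hE)

/-- **THE WEIGHT SOURCE IS HORIZONTALLY TRANSLATION-INVARIANT ON THE SLAB.**  If the slab law `∂₂v_b = μ(s,y₂)∂_bv₂` (`b = 0,1`) holds on a
space–time neighbourhood of every point `(t, y)` with `|y₂| < ρ`, then for every `x` with `|x₂| < ρ` and every horizontal `e`:
`2𝒜(t, x + e) = 2𝒜(t, x)`.  (Mean value theorem along `s ↦ x + s•e`, which stays in the slab, with `horizFDeriv_weightSource_eq_zero` at every point.) -/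
theorem weightSource_translate_eq
    (hpol : ∀ s < 0, ∀ y, ⟪curl (v s) y, EuclideanSpace.single 2 1⟫_ℝ = 0) {μ : ℝ → ℝ → ℝ}
    (hμ : ContDiff ℝ 3 (uncurry μ)) {t ρ : ℝ} (ht : t < 0)
    (hslab : ∀ y : EuclideanSpace ℝ (Fin 3), |y 2| < ρ → ∀ᶠ z in 𝓝 ((t, y) : ℝ × EuclideanSpace ℝ (Fin 3)), ∀ b : Fin 3, b ≠ 2 →
      fderiv ℝ (v z.1) z.2 (EuclideanSpace.single 2 1) b = μ z.1 (z.2 2) * fderiv ℝ (v z.1) z.2 (EuclideanSpace.single b 1) 2)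
    {x : EuclideanSpace ℝ (Fin 3)} (hx : |x 2| < ρ) {e : EuclideanSpace ℝ (Fin 3)} (he : e 2 = 0) :
    2 * (1 - μ t ((x + e) 2)) * (timeDerivWithin (Iio 0) v t (x + e) + convect (v t) (v t) (x + e) - Δ (v t) (x + e)) 2
        - 2 * (deriv (fun s => μ s ((x + e) 2)) t - deriv (deriv (μ t)) ((x + e) 2)) * v t (x + e) 2
        - deriv (μ t) ((x + e) 2) * v t (x + e) 2 ^ 2
        + 4 * deriv (μ t) ((x + e) 2) * fderiv ℝ (v t) (x + e) (EuclideanSpace.single 2 1) 2 =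
      2 * (1 - μ t (x 2)) * (timeDerivWithin (Iio 0) v t x + convect (v t) (v t) x - Δ (v t) x) 2
        - 2 * (deriv (fun s => μ s (x 2)) t - deriv (deriv (μ t)) (x 2)) * v t x 2
        - deriv (μ t) (x 2) * v t x 2 ^ 2
        + 4 * deriv (μ t) (x 2) * fderiv ℝ (v t) x (EuclideanSpace.single 2 1) 2 := by
  set F : EuclideanSpace ℝ (Fin 3) → ℝ := fun y =>
      2 * (1 - μ t (y 2)) * (timeDerivWithin (Iio 0) v t y + convect (v t) (v t) y - Δ (v t) y) 2
      - 2 * (deriv (fun s => μ s (y 2)) t - deriv (deriv (μ t)) (y 2)) * v t y 2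
      - deriv (μ t) (y 2) * v t y 2 ^ 2
      + 4 * deriv (μ t) (y 2) * fderiv ℝ (v t) y (EuclideanSpace.single 2 1) 2 with hF
  have hD : Differentiable ℝ F := differentiable_weightSource hrate hcont hmild hdiv hμ ht
  -- zero horizontal gradient at every point of the slab
  have hzero : ∀ y : EuclideanSpace ℝ (Fin 3), |y 2| < ρ → ∀ b : Fin 3, b ≠ 2 →
      fderiv ℝ F y (EuclideanSpace.single b 1) = 0 := by
    intro y hy b hb
    exact horizFDeriv_weightSource_eq_zero hrate hcont hmild hdiv hpol hμ ht y (hslab y hy) hb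
  -- the segment `s ↦ x + s • e` stays in the slab
  have hseg : ∀ s : ℝ, |(x + s • e) 2| < ρ := by
    intro s
    have : (x + s • e) 2 = x 2 := by simp [he]
    rw [this]; exact hx
  -- derivative of the source along the segment vanishes
  have hφ : ∀ s : ℝ, HasDerivAt (fun s : ℝ => F (x + s • e)) 0 s := by
    intro s
    have hl : HasDerivAt (fun s : ℝ => x + s • e) e s := by
      simpa using ((hasDerivAt_id s).smul_const e).const_add x
    have hc := ((hD (x + s • e)).hasFDerivAt).comp_hasDerivAt s hl
    have hval : fderiv ℝ F (x + s • e) e = 0 := by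
      have h0 := hzero _ (hseg s) 0 (by decide)
      have h1 := hzero _ (hseg s) 1 (by decide)
      have hdec := horizontal_decomp he
      calc fderiv ℝ F (x + s • e) e
          = fderiv ℝ F (x + s • e)
              ((e 0) • EuclideanSpace.single 0 (1 : ℝ) + (e 1) • EuclideanSpace.single 1 (1 : ℝ)) := congrArg _ hdec
        _ = 0 := by rw [map_add, map_smul, map_smul, h0, h1, smul_zero, smul_zero, add_zero]
    rw [hval] at hc
    exact hc
  have hconst := is_const_of_deriv_eq_zero (fun s => (hφ s).differentiableAt) (fun s => (hφ s).deriv) 0 1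
  simp only [zero_smul, add_zero, one_smul] at hconst
  show F (x + e) = F x
  exact hconst.symm

/-! ### Glue for the periodic branch: the horizontal translate of a class profile is a class profile with the same slab law -/

omit hrate hcont hmild hdiv in
/-- `curl` commutes with translations (cf. `Literature…FlatSwirlGauge.curl_comp_add_const`, restated to keep the imports light). -/
theorem curl_translate (w : EuclideanSpace ℝ (Fin 3) → EuclideanSpace ℝ (Fin 3)) (a y : EuclideanSpace ℝ (Fin 3)) :
    curl (fun x => w (x + a)) y = curl w (y + a) := by
  simp only [curl, fderiv_comp_add_right]

/-- **The translate `(t,x) ↦ v(t, x + a)` of a profile of the route's Type-I class is again in the class** (binder form of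
Literature `IsTypeIAncientMild.comp_add_right`): Type-I decay, continuity on the slab, the Oseen-mild identity between any two times, divergence-freeness. -/
theorem class_translate (a : EuclideanSpace ℝ (Fin 3)) :
    HasTypeITimeDecay C (fun t x => v t (x + a)) ∧
      ContinuousOn (uncurry fun t x => v t (x + a)) (Iio (0 : ℝ) ×ˢ univ) ∧
      (∀ s t : ℝ, s < t → t < 0 → ∀ x,
        (fun t x => v t (x + a)) t x =
          UnboundedOperators.heatExtension ((fun t x => v t (x + a)) s) (t - s) x -
            oseenDuhamel 1 s (fun t x => v t (x + a)) (fun t x => v t (x + a)) t x) ∧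
      (∀ t < 0, VectorCalculus.IsDivFree ((fun t x => v t (x + a)) t)) := by
  have hA : IsTypeIAncientMild C v := isTypeIAncientMild_of_class hrate hcont hmild hdiv
  have hA' : IsTypeIAncientMild C (fun t x => v t (x + a)) := IsTypeIAncientMild.comp_add_right hA a
  refine ⟨hA'.2.2.2, hA'.1.continuousOn, fun s t hst ht x => ?_, hA'.2.1⟩
  have h := hA'.2.2.1 s t hst ht x
  rwa [heatFlow_of_pos _ (sub_pos.2 hst)] at h

omit hrate hcont hmild hdiv in
/-- Poloidality passes to the translate. -/
theorem poloidal_translate (hpol : ∀ s < 0, ∀ y, ⟪curl (v s) y, EuclideanSpace.single 2 1⟫_ℝ = 0) (a : EuclideanSpace ℝ (Fin 3)) :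
    ∀ s < 0, ∀ y, ⟪curl ((fun t x => v t (x + a)) s) y, EuclideanSpace.single 2 1⟫_ℝ = 0 := by
  intro s hs y
  have h : curl (fun x => v s (x + a)) y = curl (v s) (y + a) := curl_translate (v s) a y
  show ⟪curl (fun x => v s (x + a)) y, EuclideanSpace.single 2 1⟫_ℝ = 0
  rw [h]
  exact hpol s hs (y + a)

omit hrate hcont hmild hdiv in
/-- The slab law `∂₂v_b = μ(t,x₂)∂_bv₂` (binder form of the registry, `|t+1| < ρ`, `|x₂| < ρ`) passes to the translate by a HORIZONTAL vector `a`
(`a₂ = 0`), with the same slope function `μ`. -/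
theorem slabLaw_translate {μ : ℝ → ℝ → ℝ} {ρ : ℝ}
    (hslabU : ∀ t : ℝ, |t + 1| < ρ → ∀ x : EuclideanSpace ℝ (Fin 3), |x 2| < ρ → ∀ b : Fin 3, b ≠ 2 →
      fderiv ℝ (v t) x (EuclideanSpace.single 2 1) b = μ t (x 2) * fderiv ℝ (v t) x (EuclideanSpace.single b 1) 2)
    {a : EuclideanSpace ℝ (Fin 3)} (ha : a 2 = 0) :
    ∀ t : ℝ, |t + 1| < ρ → ∀ x : EuclideanSpace ℝ (Fin 3), |x 2| < ρ → ∀ b : Fin 3, b ≠ 2 →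
      fderiv ℝ ((fun t x => v t (x + a)) t) x (EuclideanSpace.single 2 1) b =
        μ t (x 2) * fderiv ℝ ((fun t x => v t (x + a)) t) x (EuclideanSpace.single b 1) 2 := by
  intro t ht x hx b hb
  have hxa : (x + a) 2 = x 2 := by simp [ha]
  have h := hslabU t ht (x + a) (by rw [hxa]; exact hx) b hb
  rw [hxa] at h
  show fderiv ℝ (fun x => v t (x + a)) x (EuclideanSpace.single 2 1) b = μ t (x 2) * fderiv ℝ (fun x => v t (x + a)) x (EuclideanSpace.single b 1) 2
  rw [fderiv_comp_add_right]
  exact h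

end Class

end Summit.NavierStokesRegularity.NavierStokesRegularity.Theorems.PoloidalWindowDoorLrcModEntireWeightSourceTranslate

end
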